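import Mathlib
import Literature.Probability.Percolation.ArmExponentsTwoArm
import HarnessLib

/-!
# FiveArmExponentFacts

Topic `Literature/Probability/Percolation`. Named literature fact(s) relocated by the gate from `Summits/CriticalPhenomena/CardyFormulaZ2/Theorems/CardyMagicRigidityNestingRigidityFiveArmUpperT.lean`
(accept-time relocation of `[cite]`d propositions written inline in a Summits proposal; human ruling 2026-08-15).
Sources: KestenSidoraviciusZhang1998, Nolin2008, WernerPCMI2009.

* `Literature.Probability.Percolation.Nolin2008_prop17_quasiMult`
* `Literature.Probability.Percolation.Nolin2008_thm24_fiveArm_upper`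
-/

namespace Literature.Probability.Percolation

open MeasureTheory Literature.Probability.Percolation Literature.Probability.LatticeModels

/-- **Nolin 2008, Thm. 24, five-arm item — the universal exponent `α₅ = 2`, UPPER half, at a fixed
inner radius** (P. Nolin, *Near-critical percolation in two dimensions*, EJP 13 (2008) 1562–1623,
§5.2 "Universal exponents", Thm. 24, third item [arXiv 0711.4948: Thm. 23, third item]: "For any
non-constant `σ ∈ 𝔖̃₅`, `P_{1/2}(A_{5,σ}(0,N)) ≍ N^{-2}`" when `N → ∞`, together with §4.1 [arXiv
p. 8]: "for any fixed `n₁, n₂ ≥ n₀(j)`, `P̂(A_{j,σ}(n₁,N)) ≍ P̂(A_{j,σ}(n₂,N))`", `n₀(5) = 0`; the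
printed proof of the upper bound is the deterministic uniqueness "`A_v` can occur for at most one
site `v`" of a black five-arm site with a prescribed landing sequence, plus arm separation.  The
same statement, ORDER-FREE and for four occupied and one vacant arms, is H. Kesten, V. Sidoravicius,
Y. Zhang, EJP 3 (1998), Lemma 5, (3.7)–(3.8): "`P{there exist 5 disjoint paths from Δ(v + S(k)) to
Δ(v + S(n)), one of which is vacant and the other four of which are occupied} ≤ c₁₆ k² n⁻²`,
`1 ≤ k ≤ n`"; for the alternating arrangement of two open and three closed arms issued from the six
neighbours of a site, in the hexagons `Λ_m` of this library, it is W. Werner, PCMI 2009, first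
exercise sheet, "Five-arm exponent", 2(c): "`(#Λ_{m/2}) u_{2m} ≤ E(K²) < c`".)
RECORDED, in `∀∃` form and for the upper bound only: for every colour sequence `κ : Fin 5 → Bool`
taking both values and every inner radius `m ≥ 1` there is `C = C(κ, m)` with
`P_{1/2}(armEvent κ m n) ≤ C / n²` for all `n ≥ m` (`polyArmProb κ m n = P_{1/2}(armEvent κ m n)`,
`ArmEvents.lean`: five pairwise vertex-disjoint monochromatic self-avoiding paths from `∂Λ_m` to
`∂Λ_n` inside `(Λ_n ∖ Λ_m) ∪ ∂Λ_m`, `Λ_N = triBall N`).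
Cyclic order (the remark of `NearCriticalFourArmFacts.lean`, verbatim for five arms): Nolin's
`A_{5,σ}` prescribes the cyclic order `σ` of the colours around the annulus, the tree's `armEvent κ`
does not; five disjoint arms of `𝕋` crossing an annulus are cyclically ordered, so `armEvent κ m n`
is the finite union, over the cyclic arrangements `σ` of the colours of `κ` — all non-constant — of
the events `A_{5,σ}(m,n)`, and the recorded bound is the printed one summed over `σ`.  Shapes:
Nolin's and KSZ's annuli are rhombi `S_N`, ours the hexagons `Λ_N` with `Λ_N ⊆ S_N ⊆ Λ_{2N}`, which
changes constants only (restriction of arms, `armEvent_mono`/`armEvent_mono_left`; cf. the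
faithfulness notes of `ArmSeparation.lean`).  The matching LOWER bound for `κ = (T,F,T,F,F)`, at two
radii, is the tree's THEOREM `fiveArm_lowerBound` (`FiveArmLowerBound.lean`, separation-free); two
radii for the upper bound follow by quasi-multiplicativity (`Nolin2008_prop17_quasiMult`,
`fiveArmUpperT_of_nolin2008` below).  Not stronger than the two-radii statement it serves:
`pointUpperBound_of_fiveArmUpperT`.
TODO(general form): the two-sided `≍`; the cyclically ordered events `A_{5,σ}(n,N)` and their
landing-sequence versions `Ā^{I}`; the near-critical uniformity of Lemma 25 / Thm. 27
[arXiv: Lemma 24 / Thm. 26] (`P̂` between `P_p` and `P_{1-p}`, `N ≤ L(p)`).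
[cite: Nolin2008, §5.2 Thm. 24 (five-arm item) with §4.1 (arXiv 0711.4948: Thm. 23, third item, pp. 8, 16–17)] [cite: KestenSidoraviciusZhang1998, Lemma 5, (3.7)–(3.8)] [cite: WernerPCMI2009, first exercise sheet, "Five-arm exponent", 2(c)] [file Probability/Percolation/FiveArmExponentFacts] -/
def Nolin2008_thm24_fiveArm_upper : Prop :=
  ∀ κ : Fin 5 → Bool, (∃ i j, κ i ≠ κ j) → ∀ m : ℕ, 1 ≤ m → ∃ C : ℝ, ∀ n : ℕ, m ≤ n →
    polyArmProb κ m n ≤ C / (n : ℝ) ^ 2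

/-- **Nolin 2008, Prop. 17 — quasi-multiplicativity of the arm probabilities, gluing half, at
`p = 1/2`** (EJP 13 (2008), §4.5, Prop. 17 [arXiv 0711.4948: Prop. 16]: "Take `j ≥ 1` and a color
sequence `σ ∈ 𝔖̃_j`. Then `P̂(A_{j,σ}(n₁,n₂)) P̂(A_{j,σ}(n₂,n₃)) ≍ P̂(A_{j,σ}(n₁,n₃))` uniformly in
`p`, `P̂` between `P_p` and `P_{1-p}` and `n₀(j) ≤ n₁ < n₂ < n₃ ≤ L(p)`"; printed proof: "we may
assume that `n₂ ≥ 8 n₁`", then the arm-separation Thm. 11 and the extendability / gluing of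
well-separated arms, Prop. 12 and Prop. 16 [arXiv: Thm. 10, Prop. 11, Prop. 15]; after
H. Kesten, CMP 109 (1987) for four arms.)  RECORDED at `p = 1/2` (`P̂ = P_{1/2}`, where `L = ∞`), for
the order-free arm events of this library, and for the non-trivial (gluing) inequality only — the
other one is independence, the tree's `polyArmProb_submult` — in `∀∃` form with a threshold `n₀` on
the inner radius in the rôle of `n₀(j)`: for every number of arms `k` and every `κ : Fin k → Bool`
there are `c > 0` and `n₀` with
`c · P_{1/2}(armEvent κ n₁ n₂) · P_{1/2}(armEvent κ n₂ n₃) ≤ P_{1/2}(armEvent κ n₁ n₃)` for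
`n₀ ≤ n₁ < n₂ < n₃` (consecutive annuli share the sphere `∂Λ_{n₂}`, as Nolin's share `∂S_{n₂}`).
Cyclic order (verbatim the remark recorded for `Werner2009_fourArm_quasiMult` in
`NearCriticalFourArmFacts.lean`): `armEvent κ` is the union of the cyclically ordered events
`A_{k,σ}` over the cyclic arrangements `σ` of the colours of `κ`; the printed inequality holds for
each `σ`, and at `p = 1/2` any two NON-CONSTANT arrangements have comparable probabilities at every
pair of radii by colour switching (ibid. §5.1, Prop. 20 [arXiv Prop. 19]: "`P_{1/2}(A_{j,σ}(n,N)) ≍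
P_{1/2}(A_{j,σ'}(n,N))` uniformly in `n₀(j) ≤ n ≤ N`"), while a constant `κ` has a single
arrangement; hence the recorded statement follows from the printed ones (hexagons `Λ_N` for rhombi
`S_N`, constants only, as everywhere in this library).  The instance `k = 2`, `κ = (T,F)` is the
tree's named fact `Nolin2008_twoArm_quasiMult` (`ArmExponentsTwoArm.lean`), PROVED in
`ArmSeparationFinalProofs.lean` (`Nolin2008_twoArm_quasiMult_holds`): see
`twoArm_quasiMult_of_prop17`; the four-arm near-critical version is the named fact
`Werner2009_fourArm_quasiMult`.
TODO(general form): near-critical uniformity (`P̂` between `P_p` and `P_{1-p}`, `n₃ ≤ L(p)`,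
Thm. 27), the ordered and the well-separated events `Ã`, `Ā`, and Prop. 18 (arms with defects).
[cite: Nolin2008, §4.5 Prop. 17 with §5.1 Prop. 20 (arXiv 0711.4948: Prop. 16, Prop. 19)] [file Probability/Percolation/FiveArmExponentFacts] -/
def Nolin2008_prop17_quasiMult : Prop :=
  ∀ {k : ℕ} (κ : Fin k → Bool), ∃ c : ℝ, 0 < c ∧ ∃ n₀ : ℕ, ∀ n₁ n₂ n₃ : ℕ,
    n₀ ≤ n₁ → n₁ < n₂ → n₂ < n₃ →
      c * (polyArmProb κ n₁ n₂ * polyArmProb κ n₂ n₃) ≤ polyArmProb κ n₁ n₃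

/-! ## The stub from the two facts, and sanity -/

end Literature.Probability.Percolation
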